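import Mathlib.MeasureTheory.Integral.Pi
import Mathlib.Analysis.SpecialFunctions.Integrability.Basic
import Literature.MathematicalPhysics.QuantumFieldTheory.Volkov2017.SumToMaxLemma
import Literature.MathematicalPhysics.QuantumFieldTheory.Volkov2017.WholeSimplexIntegral
import HarnessLib

/-!
# Volkov 2020 (NPB 961, 115232) eq. (1.9) ⟹ «the absolute convergence of the Feynman parametric integral»: the majorant `(min z)^{1/2}/(z₁⋯z_L)` is integrable on every Hepp sector of the simplex `δ(z₁ + … + z_L − 1)` — PROVED, by the paper's own recipe (footnote 6: sector variables, `d > 0`) — and (§5) on the WHOLE simplex of (1.7), by the sum over the `L!` sectors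

independent recomputation; certified where stated, statistical where stated; no new-physics claim.

CITATION HEADER (venture `QEDPrecision`, cell `pub-qed`, track TROPICAL seat V3b = `pub-qed-trop-v3-lit-2` gen 9, §5 appended gen 10; VALUE-FREE:
integrability statements about an explicit elementary function; no Feynman integrand, nothing per graph or per word). Companion of `Volkov2020.SpeerFormHalf`
(Theorem 3.1 ⟹ (1.9): `thm31_to_eq19`) and `Volkov2020.PositiveDegreesBookkeeping` (the proof of Theorem 3.1, one-screen kernel status in
`tropical/view/V3-VOLKOV-DEGREES.md` §B.29.3); this file types the LAST sentence of the chain — from the bound (1.9) to "absolute convergence",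
i.e. the finite MEAN that §B.1 / §B.17 (1) of that view file record as "the only THEOREM in the corpus … (finite MEAN, restricted scope)" — on the
measure-theoretic simplex framework of `Volkov2017.SumToMaxLemma` (V3a: Lemma 1's projective chart, the sector `simplexSectorChart`, and
`integrableOn_simplexSectorChart_iff` = "every FINITENESS question about a δ(Σz − 1) sector integral is a question on the unit box of sector
variables") and Hepp's coordinates `Borinsky2020.HeppSectorCoordinates`. Serves §B.32 of the view file.

Source. [Volkov2020] S. Volkov, "Infrared and ultraviolet power counting on the mass shell in quantum electrodynamics", Nucl. Phys. B 961 (2020)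
115232 = arXiv:1912.04885v4 (e-print tex `iclos_arxiv.tex` held by the cell under `pub-qed-trop-v3-lit-2/sources/arxiv-1912.04885/`), VERBATIM:
* §1, after (1.5)–(1.6) (journal p.4; tex l.81–90): "|R(z,p)| ≤ C(p)·(z_{j₁})^{d₁}(z_{j₂}/z_{j₁})^{d₂}(z_{j₃}/z_{j₂})^{d₃}·…·(z_{j_L}/z_{j_{L−1}})^{d_L}
  /(z₁·z₂·…·z_L), (1.5) where j₁,…,j_L is the permutation of 1,…,L that orders z_j: z_{j₁} ≥ z_{j₂} ≥ … ≥ z_{j_L}, (1.6) … This estimation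
  immediately leads to absolute convergence of (1.2) for the given case [footnote 6: This can be proved by changing variables t₁ = z_{j₁},
  t₂ = z_{j₂}/z_{j₁}, ..., taking into account that d_j > 0 and |e^{iW(z,p)}| ≤ e^{−εt₁}.]"
* §1 (journal p.4; tex l.94–96): the Feynman parametric integral "(1.7) ∫_{z₁,…,z_L>0} I′(z₁,…,z_L,p) δ(z₁+…+z_L−1) dz₁…dz_L".
* §1 (journal p.5; tex l.113–118): "More precisely, we prove that the estimation of the form (1.5) is satisfied with d_l = max(⌈−ω(IClos({j_l,…,j_L}))⌉
  − 1/2, 1/2). … As a consequence, it is easy to see for the Feynman parametric integrand I′(z) that |I′(z)| ≤ C·(min(z₁,…,z_L))^{1/2}/(z₁·…·z_L).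
  (1.9) **This leads to the absolute convergence of the Feynman parametric integral.** The power 1/2 in (1.9) is unimprovable …; see an
  example in Appendix."

READING (the modelling steps). The integral (1.7) over the sector S_{1,…,L} = {z₁ ≥ … ≥ z_L} with δ(Σz − 1) resolved in z₁ is V3a's
`Volkov2017.simplexSectorChart m` (L = m + 2 lines; points x = (z₂,…,z_L) with (1 − Σx, x) positive and decreasing) with Lebesgue measure —
the same typing as every other simplex statement of the track (`Volkov2017.integral_simplexSectorChart_g0Fund`); "absolute convergence" =
Mathlib's `IntegrableOn`. Every other sector is this one after relabelling the lines (the majorant (1.9) is symmetric), so the per-sector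
statement is the whole content; the sum over the L! sectors of the δ-chart is done in §5 on V3a's `Volkov2017.WholeSimplexIntegral` (the whole
domain "z₁,…,z_L > 0" of (1.7) with δ resolved in z₁ is `Volkov2017.simplexChart m`; its `L!` pieces `chartSector σ` cover it and meet in
Lebesgue-null ties, `integrableOn_simplexChart_iff`; each piece is transported to S_{1,…,L} by the measure-preserving relabelling,
`integrableOn_chartSector_iff`).

WHAT THE KERNEL CERTIFIES (all PROVED; Mathlib + `Volkov2017.SumToMaxLemma` / `SectorIntegral` / `WholeSimplexIntegral` +
`Borinsky2020.HeppSectorCoordinates` only; no named fact, D-0026):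
* §1 `eq19Majorant z` = (min z)^{1/2}/∏ z (**(1.9)'s right-hand side**), `sectorMajorant z` = z_{last}^{1/2}/∏ z, `inf'_eq_last_of_chain` /
  `eq19Majorant_eq_sectorMajorant` (on the sector the minimum is the last parameter), `sectorMajorant_smul` (homogeneity of degree 1/2 − L).
* §2 **`chart_integrand_eq`** — footnote 6's change of variables carried out: on the unit box of sector variables β (V3a/Borinsky conventions:
  a = heppMap β, the point of the sector is (1, a∘rev)/(1 + Σa), Jacobians ∏_k β_k^k and (1 + Σa)^{−L}) the integrand of the sector
  integral of the majorant IS `(1 + Σ_i a_i)^{−1/2} · ∏_k β_k^{−1/2}` — each sector variable to the power d − 1 with d = 1/2 ("d_j > 0"),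
  times a factor lying in [L^{−1/2}, 1] (`Volkov2017.one_add_sum_heppMap_mem_Icc`).
* §3 `integrableOn_prod_rpow_neg_half` (∏_k β_k^{−1/2} is integrable on (0,1]^{L−1}: `Integrable.fintype_prod` of ∫₀¹ β^{−1/2}),
  `integrableOn_chartIntegrand` (times the bounded measurable factor).
* §4 **`integrableOn_sectorMajorant`** and **`integrableOn_eq19Majorant`**: the (1.9) majorant is integrable on the simplex sector against
  δ(Σz − 1) dz; **`integrableOn_of_abs_le_eq19Majorant`**: hence every a.e.-strongly-measurable integrand with |I′| ≤ C·(min z)^{1/2}/∏z on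
  the sector is absolutely integrable there — the printed "This leads to the absolute convergence of the Feynman parametric integral".
* §5 (gen 10) THE WHOLE INTEGRAL (1.7). `eq19Majorant_comp_perm` (the majorant is symmetric under relabelling the lines);
  **`integrableOn_eq19Majorant_simplexChart`**: the (1.9) majorant is integrable on the WHOLE open simplex `{z > 0, Σ z = 1}` (V3a's
  `Volkov2017.simplexChart`, δ resolved in z₁) — sector by sector (§4) via `Volkov2017.integrableOn_simplexChart_iff` and
  `Volkov2017.integrableOn_chartSector_iff`; **`integrableOn_simplexChart_of_abs_le_eq19Majorant`**: every a.e.-strongly-measurable `I′` with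
  |I′(z)| ≤ C·(min z)^{1/2}/∏z on the open simplex is absolutely integrable over it, i.e. (1.7) "∫_{z₁,…,z_L>0} I′ δ(z₁+…+z_L−1) dz₁…dz_L" converges
  absolutely — the printed sentence for the whole integral, not only per sector; `integrableOn_of_abs_le_eq19Majorant_literal` (the same over the
  literal chart `{x > 0, Σ x < 1}` with `Fin.cons (1 - ∑ i, x i) x`).
NOT claimed: that the QED integrand I′ of a given graph satisfies (1.9) (that is Theorem 3.1 + `SpeerFormHalf`, kernel status §B.29.3: modulo
Lemma 3.8 / the γ-matrix half of Lemma 3.9 / (3.12)); the measurability of I′ (a hypothesis here); the value of the integral; the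
Schwinger-parametric variant with e^{−εt₁} of footnote 6; the Appendix's sharpness example.
-/

namespace Literature.MathematicalPhysics.QuantumFieldTheory.Volkov2020

open MeasureTheory Set Real
open Borinsky2020 Volkov2017

noncomputable section

variable {m : ℕ}

/-! ## §1 The majorant of (1.9) and its form on the sector `S_{1,…,n}` -/

/-- **The right-hand side of (1.9) without the constant**: `(min(z₁,…,z_L))^{1/2}/(z₁⋯z_L)` for `L = m + 2 ≥ 2` lines.
[cite: Volkov2020, §1 eq. (1.9) (journal p.5; arXiv:1912.04885v4 tex l.116–118)] -/
def eq19Majorant (z : Fin (m + 2) → ℝ) : ℝ :=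
  (Finset.univ.inf' Finset.univ_nonempty z) ^ (1 / 2 : ℝ) / ∏ j, z j

/-- The same majorant on the sector `z_0 ≥ z_1 ≥ ⋯ ≥ z_{L−1}` (0-based), where the minimum is the last parameter:
`z_{L−1}^{1/2}/(z₀⋯z_{L−1})` — in the sector variables `z_{j_l} = t₁⋯t_l` this is Speer's form (1.5) with every `d_l = 1/2`
(`z_{j_L}^{1/2} = ∏_l t_l^{1/2}`). [cite: Volkov2020, §1 eq. (1.9) with (1.5)–(1.6) (journal p.4–5; arXiv:1912.04885v4 tex l.81–90, l.116–118)] -/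
def sectorMajorant (z : Fin (m + 2) → ℝ) : ℝ :=
  z (Fin.last (m + 1)) ^ (1 / 2 : ℝ) / ∏ j, z j

/-- On a decreasing parameter vector the minimum is the last parameter. [cite: Volkov2020, §1 eq. (1.6) (the Hepp sector z_{j₁} ≥ … ≥ z_{j_L})] -/
theorem inf'_eq_last_of_chain {z : Fin (m + 2) → ℝ} (hz : ∀ i : Fin (m + 1), z i.succ ≤ z (Fin.castSucc i)) :
    Finset.univ.inf' Finset.univ_nonempty z = z (Fin.last (m + 1)) := by
  have hanti : Antitone z := Fin.antitone_iff_succ_le.2 hz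
  refine le_antisymm (Finset.inf'_le _ (Finset.mem_univ _)) ?_
  exact Finset.le_inf' _ _ fun j _ => hanti (Fin.le_last j)

/-- Hence on the sector the (1.9) majorant IS `sectorMajorant`. [cite: Volkov2020, §1 eqs. (1.6), (1.9)] -/
theorem eq19Majorant_eq_sectorMajorant {z : Fin (m + 2) → ℝ} (hz : ∀ i : Fin (m + 1), z i.succ ≤ z (Fin.castSucc i)) :
    eq19Majorant z = sectorMajorant z := by
  unfold eq19Majorant sectorMajorant
  rw [inf'_eq_last_of_chain hz]

/-- The majorant is homogeneous of degree `1/2 − L`: `M(k z) = k^{1/2}/k^{L} · M(z)` for `k > 0`. [cite: Volkov2020, §1 eq. (1.9)] -/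
theorem sectorMajorant_smul {k : ℝ} (hk : 0 < k) (z : Fin (m + 2) → ℝ) (hz : 0 ≤ z (Fin.last (m + 1))) :
    sectorMajorant (k • z) = k ^ (1 / 2 : ℝ) / k ^ (m + 2) * sectorMajorant z := by
  unfold sectorMajorant
  simp only [Pi.smul_apply, smul_eq_mul]
  rw [Real.mul_rpow hk.le hz, Finset.prod_mul_distrib, Finset.prod_const, Finset.card_univ, Fintype.card_fin]
  ring

/-! ## §2 The majorant in the sector variables: `(1 + Σ a)^{−1/2} · ∏_k β_k^{−1/2}` -/

/-- **"changing variables t₁ = z_{j₁}, t₂ = z_{j₂}/z_{j₁}, …"** (footnote 6's recipe, here for the `δ(Σz − 1)` integral via Volkov 2017's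
Lemma 1 and Hepp's coordinates, `Volkov2017.SumToMaxLemma`): on the unit box of sector variables `β`, the simplex-sector integrand
`(Jacobian ∏ β_k^k) · (1 + Σa)^{−L} · M((1, a∘rev)/(1 + Σa))`, `a = heppMap β`, equals `(1 + Σ_i a_i)^{−1/2} · ∏_k β_k^{−1/2}` — every sector
variable to the power `d − 1` with `d = 1/2 > 0`. [cite: Volkov2020, §1 footnote 6 with eq. (1.9) (journal p.4–5; arXiv:1912.04885v4 tex l.90, l.116–118)] -/
theorem chart_integrand_eq {β : Fin (m + 1) → ℝ} (hβ : β ∈ heppUnitBox m) :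
    (∏ k : Fin (m + 1), β k ^ (k : ℕ)) • (((1 + ∑ i, heppMap β i) ^ (m + 2))⁻¹ •
        sectorMajorant ((1 + ∑ i, heppMap β i)⁻¹ • (Fin.cons 1 (heppMap β ∘ Fin.rev) : Fin (m + 2) → ℝ))) =
      (1 + ∑ i, heppMap β i) ^ (-(1 / 2 : ℝ)) * ∏ k : Fin (m + 1), β k ^ (-(1 / 2 : ℝ)) := by
  have hβpos : ∀ j, 0 < β j := fun j => (hβ j).1
  set S := 1 + ∑ i, heppMap β i with hS
  have hSpos : 0 < S := lt_of_lt_of_le one_pos (one_add_sum_heppMap_mem_Icc hβ).1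
  set w : Fin (m + 2) → ℝ := Fin.cons 1 (heppMap β ∘ Fin.rev) with hw
  have hwlast : w (Fin.last (m + 1)) = heppMap β 0 := by
    rw [hw, ← Fin.succ_last, Fin.cons_succ, Function.comp_apply, Fin.rev_last]
  have hwlast_nonneg : 0 ≤ w (Fin.last (m + 1)) := by
    rw [hwlast]; exact (heppMap_pos hβpos 0).le
  have hprodw : ∏ j, w j = ∏ i, heppMap β i := by
    rw [Fin.prod_univ_succ, hw, Fin.cons_zero, one_mul]
    simp only [Fin.cons_succ, Function.comp_apply]
    exact Equiv.prod_comp Fin.revPerm (heppMap β)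
  -- the Jacobian times the majorant at w = (1, a ∘ rev) is the product of β_k^{−1/2}
  have hmaj : (∏ k : Fin (m + 1), β k ^ (k : ℕ)) * sectorMajorant w = ∏ k : Fin (m + 1), β k ^ (-(1 / 2 : ℝ)) := by
    unfold sectorMajorant
    rw [hwlast, hprodw]
    have h0 : heppMap β 0 = ∏ k, β k := by
      rw [heppMap_apply]
      refine Finset.prod_congr ?_ fun _ _ => rfl
      ext j
      simp
    have hnum : heppMap β 0 ^ (1 / 2 : ℝ) = ∏ k, heppInv (heppMap β) k ^ (1 / 2 : ℝ) := by
      rw [heppInv_heppMap fun j => (hβpos j).ne', h0, Real.finsetProd_rpow _ _ fun k _ => (hβpos k).le]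
    rw [hnum, jacobian_mul_sectorDensity_heppMap hβpos (fun _ => (1 / 2 : ℝ))]
    refine Finset.prod_congr rfl fun k _ => ?_
    norm_num
  simp only [smul_eq_mul]
  rw [sectorMajorant_smul (inv_pos.2 hSpos) w hwlast_nonneg, ← hmaj]
  have h1 : S ^ (m + 2) ≠ 0 := pow_ne_zero _ hSpos.ne'
  have h2 : S ^ (1 / 2 : ℝ) ≠ 0 := (Real.rpow_pos_of_pos hSpos _).ne'
  have hS' : (S ^ (m + 2))⁻¹ * ((S⁻¹) ^ (1 / 2 : ℝ) / (S⁻¹) ^ (m + 2)) = S ^ (-(1 / 2 : ℝ)) := by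
    rw [inv_pow, Real.inv_rpow hSpos.le, Real.rpow_neg hSpos.le]
    field_simp
  calc (∏ k : Fin (m + 1), β k ^ (k : ℕ)) *
        ((S ^ (m + 2))⁻¹ * ((S⁻¹) ^ (1 / 2 : ℝ) / (S⁻¹) ^ (m + 2) * sectorMajorant w))
      = ((S ^ (m + 2))⁻¹ * ((S⁻¹) ^ (1 / 2 : ℝ) / (S⁻¹) ^ (m + 2))) *
          ((∏ k : Fin (m + 1), β k ^ (k : ℕ)) * sectorMajorant w) := by ring
    _ = S ^ (-(1 / 2 : ℝ)) * ((∏ k : Fin (m + 1), β k ^ (k : ℕ)) * sectorMajorant w) := by rw [hS']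

/-! ## §3 Integrability on the unit box of sector variables -/

/-- `∏_k β_k^{−1/2}` is integrable on the unit box `(0,1]^{L−1}`: "taking into account that d_j > 0" — each factor is `β^{d−1}` with `d = 1/2`,
and `∫₀¹ β^{−1/2} dβ = 2`. [cite: Volkov2020, §1 footnote 6 (journal p.4; arXiv:1912.04885v4 tex l.90)] -/
theorem integrableOn_prod_rpow_neg_half :
    IntegrableOn (fun β : Fin (m + 1) → ℝ => ∏ k, β k ^ (-(1 / 2 : ℝ))) (heppUnitBox m) := by
  rw [IntegrableOn, heppUnitBox_eq_pi, volume_pi, Measure.restrict_pi_pi]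
  refine Integrable.fintype_prod (f := fun (_ : Fin (m + 1)) (x : ℝ) => x ^ (-(1 / 2 : ℝ))) fun _ => ?_
  exact (intervalIntegral.intervalIntegrable_rpow' (a := 0) (b := 1) (by norm_num : (-1 : ℝ) < -(1 / 2))).1

/-- The whole sector-variable integrand `(1 + Σa)^{−1/2} · ∏_k β_k^{−1/2}` is integrable on the unit box (the first factor lies in
`[L^{−1/2}, 1]` there). [cite: Volkov2020, §1 footnote 6 with eq. (1.9)] -/
theorem integrableOn_chartIntegrand :
    IntegrableOn (fun β : Fin (m + 1) → ℝ =>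
      (1 + ∑ i, heppMap β i) ^ (-(1 / 2 : ℝ)) * ∏ k, β k ^ (-(1 / 2 : ℝ))) (heppUnitBox m) := by
  refine Integrable.bdd_mul (c := 1) integrableOn_prod_rpow_neg_half ?_ ?_
  · have hmeas : Measurable fun β : Fin (m + 1) → ℝ => (1 + ∑ i, heppMap β i) ^ (-(1 / 2 : ℝ)) := by
      refine Measurable.pow_const ?_ _
      simp only [heppMap]
      fun_prop
    exact hmeas.aestronglyMeasurable
  · refine ae_restrict_of_forall_mem measurableSet_heppUnitBox fun β hβ => ?_
    have hmem := one_add_sum_heppMap_mem_Icc hβ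
    rw [Real.norm_eq_abs, abs_of_pos (Real.rpow_pos_of_pos (by linarith [hmem.1]) _)]
    exact Real.rpow_le_one_of_one_le_of_nonpos hmem.1 (by norm_num)

/-! ## §4 (1.9) ⟹ absolute convergence, sector by sector -/

/-- **THE MAJORANT OF (1.9) IS INTEGRABLE ON THE SIMPLEX SECTOR** `S_{1,…,L} = {z₁ ≥ … ≥ z_L}` with `δ(z₁ + … + z_L − 1)` (resolved in
`z₁`, `Volkov2017.simplexSectorChart`): "This leads to the absolute convergence of the Feynman parametric integral" — the per-sector
content, proved by footnote 6's change of variables. (Every other sector is this one after relabelling the lines; the majorant is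
symmetric.) [cite: Volkov2020, §1 eq. (1.9) and the sentence following it, footnote 6 (journal p.4–5; arXiv:1912.04885v4 tex l.90, l.116–118)] -/
theorem integrableOn_sectorMajorant :
    IntegrableOn (fun x : Fin (m + 1) → ℝ => sectorMajorant (Fin.cons (1 - ∑ i, x i) x : Fin (m + 2) → ℝ))
      (simplexSectorChart m) := by
  rw [integrableOn_simplexSectorChart_iff sectorMajorant]
  exact integrableOn_chartIntegrand.congr_fun (fun β hβ => (chart_integrand_eq hβ).symm) measurableSet_heppUnitBox

/-- The same for the literal (1.9) majorant `(min z)^{1/2}/∏ z`. [cite: Volkov2020, §1 eq. (1.9) (journal p.5; arXiv:1912.04885v4 tex l.116–118)] -/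
theorem integrableOn_eq19Majorant :
    IntegrableOn (fun x : Fin (m + 1) → ℝ => eq19Majorant (Fin.cons (1 - ∑ i, x i) x : Fin (m + 2) → ℝ))
      (simplexSectorChart m) :=
  integrableOn_sectorMajorant.congr_fun (fun _ hx => (eq19Majorant_eq_sectorMajorant hx.2).symm)
    measurableSet_simplexSectorChart

/-- **"This leads to the absolute convergence of the Feynman parametric integral"**: any (a.e.-strongly measurable) integrand obeying
(1.9), `|I′(z)| ≤ C (min z)^{1/2}/(z₁⋯z_L)` on the sector, is absolutely integrable there against `δ(Σz − 1) dz`.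
[cite: Volkov2020, §1, the sentence after eq. (1.9) (journal p.5; arXiv:1912.04885v4 tex l.118)] -/
theorem integrableOn_of_abs_le_eq19Majorant {I' : (Fin (m + 2) → ℝ) → ℝ} {C : ℝ}
    (hmeas : AEStronglyMeasurable (fun x : Fin (m + 1) → ℝ => I' (Fin.cons (1 - ∑ i, x i) x))
      (volume.restrict (simplexSectorChart m)))
    (hle : ∀ x ∈ simplexSectorChart m,
      |I' (Fin.cons (1 - ∑ i, x i) x)| ≤ C * eq19Majorant (Fin.cons (1 - ∑ i, x i) x : Fin (m + 2) → ℝ)) :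
    IntegrableOn (fun x : Fin (m + 1) → ℝ => I' (Fin.cons (1 - ∑ i, x i) x)) (simplexSectorChart m) :=
  Integrable.mono' (integrableOn_eq19Majorant.const_mul C) hmeas
    (ae_restrict_of_forall_mem measurableSet_simplexSectorChart fun x hx => by
      rw [Real.norm_eq_abs]; exact hle x hx)

/-! ## §5 (1.9) ⟹ absolute convergence of the whole integral (1.7): the sum over the `L!` Hepp sectors

The domain "`z₁,…,z_L > 0`" of (1.7) with `δ(z₁+…+z_L − 1)` resolved in `z₁` is V3a's `Volkov2017.simplexChart m` (chart points
`x = (z₂,…,z_L)`, `Volkov2017.simplexPoint x = (1 − Σx, x)`, definitionally the `Fin.cons (1 - ∑ i, x i) x` of §4). By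
`Volkov2017.integrableOn_simplexChart_iff` a function is integrable on it iff it is integrable on each of the `L!` chart sectors
`Volkov2017.chartSector σ` (they cover the chart and meet in Lebesgue-null ties), and by `Volkov2017.integrableOn_chartSector_iff` the
sector of `σ` is the sector `S_{1,…,L}` of §4 after the measure-preserving relabelling `z ↦ z ∘ σ⁻¹`; the (1.9) majorant is invariant
under relabelling, so §4 applies to every sector verbatim ("j₁,…,j_L is the permutation of 1,…,L that orders z_j", (1.6)). -/

/-- The (1.9) majorant `(min z)^{1/2}/(z₁⋯z_L)` is a symmetric function of the parameters: relabelling the lines (passing to another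
Hepp sector (1.6)) does not change it. [cite: Volkov2020, §1 eqs. (1.6), (1.9) (journal p.4–5; arXiv:1912.04885v4 tex l.86–88, l.116–118)] -/
theorem eq19Majorant_comp_perm (z : Fin (m + 2) → ℝ) (σ : Equiv.Perm (Fin (m + 2))) :
    eq19Majorant (z ∘ ⇑σ) = eq19Majorant z := by
  unfold eq19Majorant
  have hinf : Finset.univ.inf' Finset.univ_nonempty (z ∘ ⇑σ) = Finset.univ.inf' Finset.univ_nonempty z := by
    refine le_antisymm (Finset.le_inf' _ _ fun j _ => ?_) (Finset.le_inf' _ _ fun j _ => ?_)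
    · have h := Finset.inf'_le (z ∘ ⇑σ) (Finset.mem_univ (σ.symm j))
      simpa using h
    · exact Finset.inf'_le z (Finset.mem_univ (σ j))
  have hprod : ∏ j, (z ∘ ⇑σ) j = ∏ j, z j := Equiv.prod_comp σ z
  rw [hinf, hprod]

/-- **THE MAJORANT OF (1.9) IS INTEGRABLE ON THE WHOLE SIMPLEX** `{z₁,…,z_L > 0, z₁+…+z_L = 1}` of (1.7) (δ resolved in `z₁`:
V3a's `Volkov2017.simplexChart`): the `L!` per-sector statements `integrableOn_eq19Majorant` (§4, footnote 6's change of variables),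
one for each Hepp sector (1.6) after relabelling the lines (`eq19Majorant_comp_perm`, `Volkov2017.integrableOn_chartSector_iff`), glued
by `Volkov2017.integrableOn_simplexChart_iff` (the sectors cover the simplex; their pairwise intersections are null).
[cite: Volkov2020, §1 eq. (1.7), eqs. (1.6)/(1.9) and the sentence after (1.9) "This leads to the absolute convergence of the Feynman
parametric integral", footnote 6 (journal p.4–5; arXiv:1912.04885v4 tex l.86–96, l.116–118)] -/
theorem integrableOn_eq19Majorant_simplexChart :
    IntegrableOn (fun x : Fin (m + 1) → ℝ => eq19Majorant (simplexPoint x)) (simplexChart m) := by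
  rw [integrableOn_simplexChart_iff]
  intro σ
  rw [integrableOn_chartSector_iff σ eq19Majorant]
  simp_rw [eq19Majorant_comp_perm]
  exact integrableOn_eq19Majorant

/-- **"This leads to the absolute convergence of the Feynman parametric integral" — for the WHOLE integral (1.7)**
`∫_{z₁,…,z_L>0} I′(z₁,…,z_L) δ(z₁+…+z_L−1) dz₁…dz_L`: every (a.e.-strongly measurable) integrand obeying (1.9),
`|I′(z)| ≤ C·(min(z₁,…,z_L))^{1/2}/(z₁⋯z_L)` on the open simplex, is absolutely integrable over it (δ resolved in `z₁`, V3a's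
`Volkov2017.simplexChart`; `Volkov2017.simplexPoint x = (1 − Σx, x)`). This is the finite-MEAN statement of the paper for the class of
integrands it covers; nothing is said or typed about `∫ I′²` (cf. §1, tex l.122: "When f(z) is not square-integrable …").
[cite: Volkov2020, §1 eq. (1.7) and the sentence after eq. (1.9) (journal p.4–5; arXiv:1912.04885v4 tex l.94–96, l.118)] -/
theorem integrableOn_simplexChart_of_abs_le_eq19Majorant {I' : (Fin (m + 2) → ℝ) → ℝ} {C : ℝ}
    (hmeas : AEStronglyMeasurable (fun x : Fin (m + 1) → ℝ => I' (simplexPoint x))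
      (volume.restrict (simplexChart m)))
    (hle : ∀ x ∈ simplexChart m, |I' (simplexPoint x)| ≤ C * eq19Majorant (simplexPoint x)) :
    IntegrableOn (fun x : Fin (m + 1) → ℝ => I' (simplexPoint x)) (simplexChart m) :=
  Integrable.mono' (integrableOn_eq19Majorant_simplexChart.const_mul C) hmeas
    (ae_restrict_of_forall_mem measurableSet_simplexChart fun x hx => by
      rw [Real.norm_eq_abs]; exact hle x hx)

/-- The same statement over the literal chart domain `{x | x > 0, Σ x < 1}` with the literal simplex point `Fin.cons (1 - ∑ i, x i) x`
(the typing of `Volkov2017.integral_simplexChart_eq_totalW'`): (1.9) on `{z > 0, Σ z = 1}` ⟹ (1.7) converges absolutely.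
[cite: Volkov2020, §1 eq. (1.7) and the sentence after eq. (1.9) (journal p.4–5; arXiv:1912.04885v4 tex l.94–96, l.118)] -/
theorem integrableOn_of_abs_le_eq19Majorant_literal {I' : (Fin (m + 2) → ℝ) → ℝ} {C : ℝ}
    (hmeas : AEStronglyMeasurable (fun x : Fin (m + 1) → ℝ => I' (Fin.cons (1 - ∑ i, x i) x))
      (volume.restrict {x : Fin (m + 1) → ℝ | (∀ i, 0 < x i) ∧ ∑ i, x i < 1}))
    (hle : ∀ x : Fin (m + 1) → ℝ, (∀ i, 0 < x i) → ∑ i, x i < 1 →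
      |I' (Fin.cons (1 - ∑ i, x i) x)| ≤ C * eq19Majorant (Fin.cons (1 - ∑ i, x i) x : Fin (m + 2) → ℝ)) :
    IntegrableOn (fun x : Fin (m + 1) → ℝ => I' (Fin.cons (1 - ∑ i, x i) x))
      {x : Fin (m + 1) → ℝ | (∀ i, 0 < x i) ∧ ∑ i, x i < 1} := by
  have hset : {x : Fin (m + 1) → ℝ | (∀ i, 0 < x i) ∧ ∑ i, x i < 1} = simplexChart m :=
    Set.ext fun _ => mem_simplexChart_iff.symm
  rw [hset] at hmeas ⊢
  exact integrableOn_simplexChart_of_abs_le_eq19Majorant hmeas fun x hx =>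
    hle x (mem_simplexChart_iff.mp hx).1 (mem_simplexChart_iff.mp hx).2

end

end Literature.MathematicalPhysics.QuantumFieldTheory.Volkov2020
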